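import Summits.QuantumAdvantage.QuantumAdvantage.Theses.SpinorFlattening
import Summits.QuantumAdvantage.QuantumAdvantage.Theorems.SpinorFlatteningNegApproxGaussRankSuperpolyMassBound
import Summits.QuantumAdvantage.QuantumAdvantage.Theorems.NegApproxGaussRankSuperpoly.Negative.LoadBearing
import Literature.Computability.QuantumComplexity.GaussianRank

/-!
# Crux `SpinorFlattening.GaussRankPolyImpliesPPoly` (stmt-QuantumAdvantage-1247) — negative lemmas: exponential coefficients are forced

Disprover's support file (refuter-cdisprove-stmt-QuantumAdvantage-1247-g2-0, gen 2, 2026-08-16; work file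
`Cruxes/GaussRankPolyImpliesPPoly/Disproof.lean` §7). The crux is `GaussRankPolyThesis → BQP ⊆ PPoly`
(polynomial approximate Gaussian rank `X` of `|M⟩^{⊗t}` ⇒ non-uniform dequantization). A NON-vacuous proof
must package approximate Gaussian decompositions as polynomial-size advice; this file quantifies the
obstruction on the coefficient side:

* `one_sub_le_sqrt_mul_sum_norm` — the `ℓ¹` LOWER BOUND: if `‖ψ‖ = 1`, `‖ψ − Σ aᵢ gᵢ‖ ≤ δ` and every
  overlap has `|⟨ψ, gᵢ⟩|² ≤ F`, then `(1 − δ) ≤ √F · Σ ‖aᵢ‖` (Cauchy–Schwarz on `QReg n → ℂ`, transported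
  to `EuclideanSpace ℂ (QReg n)`);
* (reused, not redeclared: `‖M^{⊗t}‖² = 1` is `NegApproxGaussRankSuperpoly.Negative.normSq_magicMPow` of the
  sibling crux's negative file, and `‖toLp 2 x‖² = normSq x` is `SpinorFlattening.massBound_norm_sq_toLp` of the
  landed mass bound);
* `not_polyCoeffThesis_of_fidelityBound` — GIVEN the printed Gaussian-fidelity bound
  `F_𝒢(M^{⊗t}) ≤ 2^{-t}` (CudbyStrelchuk2023 Lemma 3 with App. 9; hypothesis `hF`, not yet a tree fact),
  the natural strengthening of the route's target `X` with unit Gaussian terms AND polynomially bounded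
  coefficients `‖aᵢ‖ ≤ t^c + c` is FALSE: at `δ = 1/2`, `2^{t/2}/2 ≤ Σ‖aᵢ‖ ≤ (t^c + c)²` fails for large
  `t` (`exists_two_pow_gt`). Hence every decomposition the hypothesis `X` could supply carries
  coefficients of modulus `≥ 2^{t/2}/(2r)`: `Θ(t)` bits per amplitude are the floor of any packaging.
-/

set_option linter.dupNamespace false

noncomputable section

namespace Summit.QuantumAdvantage.QuantumAdvantage.Theorems.GaussRankPolyImpliesPPoly.Negative

open Literature.Computability.Cryptography Literature.Computability.QuantumComplexity
open Summit.QuantumAdvantage.QuantumAdvantage.Theses.SpinorFlattening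
open Summit.QuantumAdvantage.QuantumAdvantage.Theorems.SpinorFlattening (massBound_norm_sq_toLp)
open Summit.QuantumAdvantage.QuantumAdvantage.Theorems.NegApproxGaussRankSuperpoly.Negative (normSq_magicMPow)
open Matrix

/-! ### The Hermitian form `star ψ ⬝ᵥ χ` on `QReg n → ℂ` -/

/-- **Cauchy–Schwarz** for the Hermitian form: `|⟨ψ, χ⟩|² ≤ ‖ψ‖² ‖χ‖²`. [folklore] -/
theorem norm_star_dotProduct_sq_le {n : ℕ} (ψ χ : QReg n → ℂ) :
    ‖star ψ ⬝ᵥ χ‖ ^ 2 ≤ normSq ψ * normSq χ := by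
  have h := norm_inner_le_norm (𝕜 := ℂ) (WithLp.toLp 2 ψ : EuclideanSpace ℂ (QReg n))
    (WithLp.toLp 2 χ : EuclideanSpace ℂ (QReg n))
  rw [EuclideanSpace.inner_toLp_toLp, dotProduct_comm] at h
  have h2 := pow_le_pow_left₀ (norm_nonneg _) h 2
  rwa [mul_pow, massBound_norm_sq_toLp, massBound_norm_sq_toLp] at h2

/-- `⟨ψ, ψ⟩ = ‖ψ‖²` as a complex number. [folklore] -/
theorem star_dotProduct_self_eq_normSq {n : ℕ} (ψ : QReg n → ℂ) :
    star ψ ⬝ᵥ ψ = ((normSq ψ : ℝ) : ℂ) := by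
  unfold dotProduct normSq
  push_cast
  refine Finset.sum_congr rfl fun x _ => ?_
  rw [Pi.star_apply, Complex.star_def, Complex.conj_mul']

/-! ### The `ℓ¹` lower bound -/

/-- **`ℓ¹` LOWER BOUND** (extent-type): if `‖ψ‖ = 1`, `‖ψ − Σ aᵢ gᵢ‖ ≤ δ` and `|⟨ψ, gᵢ⟩|² ≤ F` for all `i`,
then `1 − δ ≤ √F · Σ ‖aᵢ‖`. (`⟨ψ, Σ aᵢgᵢ⟩ = 1 − ⟨ψ, ψ − Σ aᵢgᵢ⟩` has modulus `≥ 1 − δ` by Cauchy–Schwarz and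
`≤ √F Σ‖aᵢ‖` termwise.) [cite: CudbyStrelchuk2023, §5.2 (ξ_G ≥ 1/F_G)] -/
theorem one_sub_le_sqrt_mul_sum_norm {n r : ℕ} (ψ : QReg n → ℂ) (a : Fin r → ℂ)
    (g : Fin r → QReg n → ℂ) {δ F : ℝ} (hδ : 0 ≤ δ) (hψ : normSq ψ = 1)
    (herr : normSq (ψ - ∑ i, a i • g i) ≤ δ ^ 2)
    (hov : ∀ i, ‖star ψ ⬝ᵥ g i‖ ^ 2 ≤ F) :
    1 - δ ≤ Real.sqrt F * ∑ i, ‖a i‖ := by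
  set φ : QReg n → ℂ := ∑ i, a i • g i with hφ
  have h1 : star ψ ⬝ᵥ φ = 1 - star ψ ⬝ᵥ (ψ - φ) := by
    rw [dotProduct_sub, star_dotProduct_self_eq_normSq, hψ]
    push_cast
    ring
  have h2 : ‖star ψ ⬝ᵥ (ψ - φ)‖ ≤ δ := by
    have hcs := norm_star_dotProduct_sq_le ψ (ψ - φ)
    rw [hψ, one_mul] at hcs
    calc ‖star ψ ⬝ᵥ (ψ - φ)‖ = Real.sqrt (‖star ψ ⬝ᵥ (ψ - φ)‖ ^ 2) :=
          (Real.sqrt_sq (norm_nonneg _)).symm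
      _ ≤ Real.sqrt (δ ^ 2) := Real.sqrt_le_sqrt (hcs.trans herr)
      _ = δ := Real.sqrt_sq hδ
  have h3 : 1 - δ ≤ ‖star ψ ⬝ᵥ φ‖ := by
    rw [h1]
    have := norm_sub_norm_le (1 : ℂ) (star ψ ⬝ᵥ (ψ - φ))
    rw [norm_one] at this
    linarith
  have h4 : ‖star ψ ⬝ᵥ φ‖ ≤ Real.sqrt F * ∑ i, ‖a i‖ := by
    have hexp : star ψ ⬝ᵥ φ = ∑ i, a i * (star ψ ⬝ᵥ g i) := by
      simp only [hφ, dotProduct_sum, dotProduct_smul, smul_eq_mul]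
    rw [hexp, Finset.mul_sum]
    refine (norm_sum_le _ _).trans (Finset.sum_le_sum fun i _ => ?_)
    rw [norm_mul, mul_comm]
    have hgi : ‖star ψ ⬝ᵥ g i‖ ≤ Real.sqrt F := by
      have := Real.abs_le_sqrt (hov i)
      rwa [abs_of_nonneg (norm_nonneg _)] at this
    exact mul_le_mul_of_nonneg_right hgi (norm_nonneg _)
  exact h3.trans h4

/-! ### The poly-coefficient strengthening of `X` is false modulo the printed fidelity bound -/

/-- Exponentials beat polynomials: some `t ≥ 1` has `4 (t^c + c)^4 < 2^t`. [folklore] -/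
theorem exists_two_pow_gt (c : ℕ) : ∃ t : ℕ, 1 ≤ t ∧ 4 * ((t : ℝ) ^ c + c) ^ 4 < (2 : ℝ) ^ t := by
  have hlo := isLittleO_pow_const_const_pow_of_one_lt (R := ℝ) (4 * c) (one_lt_two)
  have hε : (0 : ℝ) < 1 / (8 * ((c : ℝ) + 1) ^ 4) := by positivity
  obtain ⟨N, hN⟩ := Filter.eventually_atTop.1 (hlo.def hε)
  refine ⟨max N 1, le_max_right _ _, ?_⟩
  have h1t : (1 : ℝ) ≤ (max N 1 : ℕ) := by exact_mod_cast le_max_right N 1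
  have hb := hN (max N 1) (le_max_left _ _)
  rw [Real.norm_of_nonneg (by positivity), Real.norm_of_nonneg (by positivity)] at hb
  set T : ℝ := ((max N 1 : ℕ) : ℝ) with hT
  have hpoly : (T ^ c + c) ^ 4 ≤ ((c : ℝ) + 1) ^ 4 * T ^ (4 * c) := by
    have hTc : (1 : ℝ) ≤ T ^ c := one_le_pow₀ h1t
    have hle : T ^ c + c ≤ ((c : ℝ) + 1) * T ^ c := by
      nlinarith [(Nat.cast_nonneg c : (0 : ℝ) ≤ c)]
    calc (T ^ c + c) ^ 4 ≤ (((c : ℝ) + 1) * T ^ c) ^ 4 := pow_le_pow_left₀ (by positivity) hle 4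
      _ = ((c : ℝ) + 1) ^ 4 * T ^ (4 * c) := by rw [mul_pow, ← pow_mul, mul_comm c 4]
  have h2pos : (0 : ℝ) < 2 ^ (max N 1) := by positivity
  calc 4 * (T ^ c + c) ^ 4 ≤ 4 * (((c : ℝ) + 1) ^ 4 * T ^ (4 * c)) := by gcongr
    _ ≤ 4 * (((c : ℝ) + 1) ^ 4 * (1 / (8 * ((c : ℝ) + 1) ^ 4) * 2 ^ (max N 1))) := by gcongr
    _ = 2 ^ (max N 1) / 2 := by field_simp; ring
    _ < 2 ^ (max N 1) := by linarith

/-- **The poly-coefficient strengthening of `X` is FALSE given the printed fidelity bound.** Hypothesis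
`hF`: `|⟨M^{⊗t}, g⟩|² ≤ 2^{-t} ‖g‖²` for every Gaussian `g` (`F_𝒢(M^{⊗t}) ≤ 2^{-t}`; CudbyStrelchuk2023
Lemma 3 + App. 9, an SDP-dual certificate from the quadratic Gaussian constraints — printed, not yet a tree
fact). Conclusion: there is NO `c` such that for all `t` some `≤ t^c + c` UNIT Gaussian terms with
coefficients of modulus `≤ t^c + c` approximate `|M⟩^{⊗t}` to `normSq ≤ 1/4` — indeed at `δ = 1/2` the `ℓ¹`
bound gives `2^{t/2}/2 ≤ Σ‖aᵢ‖ ≤ (t^c+c)²`. So coefficients of modulus `≥ 2^{t/2}/(2r)` are forced in any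
decomposition the route's target `X` could supply. [cite: CudbyStrelchuk2023, Lemma 3] -/
theorem not_polyCoeffThesis_of_fidelityBound
    (hF : ∀ (t : ℕ) (g : QReg (t * 4) → ℂ), IsGaussian g →
      ‖star (magicMPow t) ⬝ᵥ g‖ ^ 2 ≤ ((1 : ℝ) / 2) ^ t * normSq g) :
    ¬ ∀ δ : ℝ, 0 < δ → ∃ c : ℕ, ∀ t : ℕ, ∃ r : ℕ, r ≤ t ^ c + c ∧
      ∃ (a : Fin r → ℂ) (g : Fin r → QReg (t * 4) → ℂ),
        (∀ i, IsGaussian (g i) ∧ normSq (g i) = 1 ∧ ‖a i‖ ≤ (t : ℝ) ^ c + c) ∧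
          normSq (magicMPow t - ∑ i, a i • g i) ≤ δ ^ 2 := by
  intro hX
  obtain ⟨c, hc⟩ := hX (1 / 2) one_half_pos
  obtain ⟨t, -, ht⟩ := exists_two_pow_gt c
  obtain ⟨r, hr, a, g, hg, herr⟩ := hc t
  have hov : ∀ i, ‖star (magicMPow t) ⬝ᵥ g i‖ ^ 2 ≤ ((1 : ℝ) / 2) ^ t := fun i => by
    have := hF t (g i) (hg i).1
    rwa [(hg i).2.1, mul_one] at this
  have hl1 := one_sub_le_sqrt_mul_sum_norm (magicMPow t) a g (by norm_num : (0 : ℝ) ≤ 1 / 2)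
    (normSq_magicMPow t) herr hov
  have hsum : ∑ i, ‖a i‖ ≤ ((t : ℝ) ^ c + c) ^ 2 := by
    calc ∑ i, ‖a i‖ ≤ ∑ _i : Fin r, ((t : ℝ) ^ c + c) := Finset.sum_le_sum fun i _ => (hg i).2.2
      _ = r * ((t : ℝ) ^ c + c) := by
          rw [Finset.sum_const, Finset.card_univ, Fintype.card_fin, nsmul_eq_mul]
      _ ≤ ((t : ℝ) ^ c + c) * ((t : ℝ) ^ c + c) := by
          gcongr
          exact_mod_cast hr
      _ = ((t : ℝ) ^ c + c) ^ 2 := (sq _).symm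
  have h1 : (1 : ℝ) / 2 ≤ Real.sqrt (((1 : ℝ) / 2) ^ t) * ((t : ℝ) ^ c + c) ^ 2 := by
    have := mul_le_mul_of_nonneg_left hsum (Real.sqrt_nonneg (((1 : ℝ) / 2) ^ t))
    linarith
  have h2 : ((1 : ℝ) / 2) ^ 2 ≤ ((1 : ℝ) / 2) ^ t * ((t : ℝ) ^ c + c) ^ 4 := by
    have := pow_le_pow_left₀ (by norm_num) h1 2
    rw [mul_pow, Real.sq_sqrt (by positivity), ← pow_mul] at this
    simpa using this
  have hhalf : (2 : ℝ) ^ t * ((1 : ℝ) / 2) ^ t = 1 := by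
    rw [← mul_pow]; norm_num
  have h3 : (2 : ℝ) ^ t ≤ 4 * ((t : ℝ) ^ c + c) ^ 4 := by
    have h4 := mul_le_mul_of_nonneg_left h2 (by positivity : (0 : ℝ) ≤ 4 * 2 ^ t)
    calc (2 : ℝ) ^ t = 4 * 2 ^ t * ((1 : ℝ) / 2) ^ 2 := by ring
      _ ≤ 4 * 2 ^ t * (((1 : ℝ) / 2) ^ t * ((t : ℝ) ^ c + c) ^ 4) := h4
      _ = 4 * ((t : ℝ) ^ c + c) ^ 4 * ((2 : ℝ) ^ t * ((1 : ℝ) / 2) ^ t) := by ring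
      _ = 4 * ((t : ℝ) ^ c + c) ^ 4 := by rw [hhalf, mul_one]
  linarith

end Summit.QuantumAdvantage.QuantumAdvantage.Theorems.GaussRankPolyImpliesPPoly.Negative
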